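import Literature.Combinatorics.SimpleGraph.TreeFiniteSupportHarmonic                    -- ★-to-be (T-H): `TreeHarmonic.eq_zero_of_forall_finsum_dist_two_eq`
import Literature.NumberTheory.Automorphic.AdmissibleInvariantFormSchur                   -- ★ E2-1 A: `Representation.IsSupercuspidal.hasCompactSupport_matrixCoeff` (+ brings `contragredient`, `IsSmooth`)
import Literature.NumberTheory.Automorphic.SmoothProjector                                -- ★ `SmoothProjector.avgLinear` (the averaging projector `e_K`), `avg_apply_of_mem`, `avg_eq_self_of_mem_fixedPoints`
import Mathlib.LinearAlgebra.Eigenspace.Triangularizable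
import Mathlib.Analysis.Complex.Polynomial.Basic
import HarnessLib

/-!
# A supercuspidal representation has no vector fixed by a vertex stabiliser of a tree on which the group acts («SC-NO-PARAHORIC», generic layer)

Topic `RepresentationTheory` (namespace `Literature.RepresentationTheory.TreeAction`); THEOREMS ONLY — no definition, no instance, no notation, no named fact.
Generic in the group `G`, the tree `X` and the representation `ρ`; no lattice, no `U(3)`, no Hecke algebra.

THE MATHEMATICS (the elementary «tree-harmonic» route to [Borel1976, §4; Casselman1995, Prop. 3.3.6]-type vanishing for SUPERCUSPIDALS).  `G` acts on a
LEAFLESS TREE `X` (vertex set `W`, `MulAction G W` preserving `X.dist`), `x₀ ∈ W` has stabiliser `K`, the orbit `G·x₀` is closed under distance-`2` steps (one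
colour class of a bipartite tree) and the distance-`2` sphere `S₂(x₀)` is FINITE with a section `sec : S₂(x₀) → G` (`sec y · x₀ = y`).  For a representation
`ρ` of `G` on `V` and a `K`-FIXED `v` the GEOMETRIC OPERATOR `A v := Σ_{y ∈ S₂(x₀)} ρ(sec y) v` does not depend on `sec` and commutes with `K` (§1), so it is an
endomorphism of `V^K`.  If `A v = λ v` and a linear form `ℓ` has `g ↦ ℓ(ρ(g) v)` supported on finitely many vertices `g·x₀`, the vertex function
`f(g·x₀) := ℓ(ρ(g) v)` (well defined, `v` being `K`-fixed) is finitely supported on the orbit and satisfies `Σ_{dist(x,t)=2} f(t) = λ f(x)` there — so `f = 0` by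
★ (T-H) `TreeHarmonic.eq_zero_of_forall_finsum_dist_two_eq`, i.e. **`ℓ v = 0`** (§2).  Consequently (§3) `V^K = 0` as soon as `V^K` is finite-dimensional (an
eigenvector of `A` exists over `ℂ`) and every non-zero `K`-fixed vector has SOME such finitely supported `ℓ` not vanishing on it; and (§4) for a SMOOTH
SUPERCUSPIDAL `ρ` of a topological group with COMPACT CENTRE and `K` COMPACT OPEN this is automatic: `ℓ := ℓ₀ ∘ e_K` (★ `SmoothProjector.avgLinear`) is a smooth
linear form, so `g ↦ ℓ(ρ(g)v)` is compactly supported (★ `IsSupercuspidal.hasCompactSupport_matrixCoeff`), hence supported on finitely many cosets `gK` = vertices.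

* §1 `dist_smul_eq_of_forall_adj_iff` (adjacency-preserving actions preserve `dist`), `apply_eq_apply_of_smul_eq` (a `K`-fixed vector's translate depends only on
  the vertex `g·x₀`), `dist_smul_eq_of_mem` (`K` preserves distances from `x₀`), `sum_sphere_apply_eq` (choice-independence of `A`), `apply_sum_sphere_eq`
  (`ρ(k) (A v) = A v`), `sum_sphere_mem_fixedPoints`.
* §2 **`dual_apply_eq_zero_of_sum_sphere_eq_smul`** — `A v = λ v`, `ℓ ∘ ρ(·) v` finitely supported on vertices ⇒ `ℓ v = 0`.
* §3 **`forall_mem_fixedPoints_eq_zero_of_separating`** — `V^K` finite-dimensional + finitely supported separating forms ⇒ `V^K = 0`.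
* §4 **`fixedPoints_eq_bot_of_isSupercuspidal`** — `ρ` smooth supercuspidal, `Z(G)` compact, `K` compact open vertex stabiliser, `V^K` finite-dimensional ⇒ `V^K = ⊥`.
* §5 **`fixedPoints_eq_bot_of_isSupercuspidal_of_permHom`** — the same with the action handed over as `act : G →* Equiv.Perm W` preserving adjacency (no `MulAction`
  instance at the call site; `MulAction.compHom` inside).

WHY (consumer-in-waiting).  Census EP-G row (G6)-SC «SC-NO-PARAHORIC ∕ SC-NO-IWAHORI» (cell `hodgecm-mathlib`, G-ROW LEDGER v2, dealer F0P3a-p09 (g13)): the THIN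
`U(Φ₃)` dress instantiates §4 on the ★ lattice tree (`UnitaryLatticeTreeDefs`, `isTree_latticeGraph_three_of_unramified`, vertex stabilisers `K₀ = U(𝒪)`, `K₁`,
valencies `q³+1`, `q+1`, transitivity) to get `π^{K₀} = π^{K₁} = 0` for supercuspidal `π`, whence `π^{I} = 0` for the Iwahori `I = K₀ ⊓ K₁` (★ (T-H) §2).

References.  [cite: Serre1980Trees, Ch. II §1.1–1.3 (the tree of `SL₂`; vertex stabilisers; the action on the tree)]
[cite: Casselman1995, §2.1 (the projector `e_K` as a finite average); §3.3 (Jacquet modules and Iwahori-fixed vectors — the statement bypassed here)]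
-/

open SimpleGraph Literature.NumberTheory.Automorphic
open scoped Pointwise

namespace Literature.RepresentationTheory.TreeAction

/-! ## §1 The geometric distance-two operator of a vertex stabiliser -/

section Algebra

variable {G : Type*} [Group G] {W : Type*} [MulAction G W] {X : SimpleGraph W}
variable {V : Type*} [AddCommGroup V] [Module ℂ V] (ρ : Representation ℂ G V)
variable {x₀ : W} {K : Subgroup G}

omit [AddCommGroup V] [Module ℂ V] in
/-- **An adjacency-preserving action preserves graph distances** (map a shortest walk by `g` and by `g⁻¹`; non-reachable pairs stay non-reachable). The
distance form `hdist` used below is thus available from the adjacency form (e.g. from a graph automorphism such as ★ `latticeGraphIso`).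
[cite: Serre1980Trees, Ch. II §1.1–1.3] -/
theorem dist_smul_eq_of_forall_adj_iff (hadj : ∀ (g : G) (x y : W), X.Adj (g • x) (g • y) ↔ X.Adj x y) (g : G) (x y : W) :
    X.dist (g • x) (g • y) = X.dist x y := by
  have key : ∀ (g : G) (x y : W), X.dist (g • x) (g • y) ≤ X.dist x y := by
    intro g x y
    let f : X →g X := ⟨fun w => g • w, fun {a b} h => (hadj g a b).2 h⟩
    by_cases hr : X.Reachable x y
    · obtain ⟨p, -, hp⟩ := hr.exists_path_of_dist
      have h := SimpleGraph.dist_le (p.map f)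
      rw [Walk.length_map, hp] at h
      exact h
    · have hr' : ¬ X.Reachable (g • x) (g • y) := by
        intro h
        apply hr
        let f' : X →g X := ⟨fun w => g⁻¹ • w, fun {a b} h => (hadj g⁻¹ a b).2 h⟩
        have h' := h.map f'
        simpa [f'] using h'
      rw [SimpleGraph.dist_eq_zero_of_not_reachable hr, SimpleGraph.dist_eq_zero_of_not_reachable hr']
  refine le_antisymm (key g x y) ?_
  have h := key g⁻¹ (g • x) (g • y)
  rwa [inv_smul_smul, inv_smul_smul] at h

/-- **A `K`-fixed vector's translate `ρ(g) v` depends only on the vertex `g·x₀`** (`K` = the stabiliser of `x₀`). [cite: Serre1980Trees, Ch. II §1.1–1.3] -/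
theorem apply_eq_apply_of_smul_eq (hK : ∀ g : G, g ∈ K ↔ g • x₀ = x₀) {v : V} (hv : ∀ k ∈ K, ρ k v = v) {g g' : G}
    (h : g • x₀ = g' • x₀) : ρ g v = ρ g' v := by
  have hk : g'⁻¹ * g ∈ K := by rw [hK, mul_smul, h, inv_smul_smul]
  calc ρ g v = ρ (g' * (g'⁻¹ * g)) v := by rw [mul_inv_cancel_left]
    _ = ρ g' (ρ (g'⁻¹ * g) v) := by rw [map_mul, Module.End.mul_apply]
    _ = ρ g' v := by rw [hv _ hk]

/-- **The stabiliser permutes the distance-two sphere** (indeed every distance sphere about `x₀`). [cite: Serre1980Trees, Ch. II §1.1–1.3] -/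
theorem dist_smul_eq_of_mem (hdist : ∀ (g : G) (x y : W), X.dist (g • x) (g • y) = X.dist x y) (hK : ∀ g : G, g ∈ K ↔ g • x₀ = x₀)
    {k : G} (hk : k ∈ K) (y : W) : X.dist x₀ (k • y) = X.dist x₀ y := by
  conv_lhs => rw [← (hK k).1 hk]
  exact hdist k x₀ y

/-- **Choice-independence of the geometric operator**: two sections of `S₂(x₀) → G` give the same `Σ_{y ∈ S₂} ρ(sec y) v` on a `K`-fixed `v`.
[cite: Serre1980Trees, Ch. II §1.1–1.3] -/
theorem sum_sphere_apply_eq (hK : ∀ g : G, g ∈ K ↔ g • x₀ = x₀) (S₂ : Finset W) {sec sec' : W → G} (hsec : ∀ y ∈ S₂, sec y • x₀ = y)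
    (hsec' : ∀ y ∈ S₂, sec' y • x₀ = y) {v : V} (hv : ∀ k ∈ K, ρ k v = v) :
    ∑ y ∈ S₂, ρ (sec y) v = ∑ y ∈ S₂, ρ (sec' y) v :=
  Finset.sum_congr rfl fun y hy => apply_eq_apply_of_smul_eq ρ hK hv (by rw [hsec y hy, hsec' y hy])

/-- **The geometric operator commutes with the stabiliser**: `ρ(k) (Σ_{y ∈ S₂(x₀)} ρ(sec y) v) = Σ_{y ∈ S₂(x₀)} ρ(sec y) v` for `k ∈ K` and `K`-fixed `v`
(`k` permutes `S₂(x₀)` and `k · sec y · x₀ = k·y = sec (k·y) · x₀`). [cite: Serre1980Trees, Ch. II §1.1–1.3] -/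
theorem apply_sum_sphere_eq (hdist : ∀ (g : G) (x y : W), X.dist (g • x) (g • y) = X.dist x y) (hK : ∀ g : G, g ∈ K ↔ g • x₀ = x₀)
    (S₂ : Finset W) (hS₂ : ∀ y, y ∈ S₂ ↔ X.dist x₀ y = 2) {sec : W → G} (hsec : ∀ y ∈ S₂, sec y • x₀ = y)
    {v : V} (hv : ∀ k ∈ K, ρ k v = v) {k : G} (hk : k ∈ K) :
    ρ k (∑ y ∈ S₂, ρ (sec y) v) = ∑ y ∈ S₂, ρ (sec y) v := by
  rw [map_sum]
  have hmem : ∀ {k : G}, k ∈ K → ∀ y ∈ S₂, k • y ∈ S₂ := fun hk y hy => by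
    rw [hS₂, dist_smul_eq_of_mem hdist hK hk]; exact (hS₂ y).1 hy
  -- reindex along the permutation `y ↦ k • y` of `S₂`
  refine Finset.sum_bij' (fun y _ => k • y) (fun y _ => k⁻¹ • y) (fun y hy => hmem hk y hy) (fun y hy => hmem (K.inv_mem hk) y hy)
    (fun y _ => inv_smul_smul k y) (fun y _ => smul_inv_smul k y) (fun y hy => ?_)
  -- `ρ k (ρ (sec y) v) = ρ (sec (k • y)) v`: both group elements move `x₀` to `k • y`
  rw [← Module.End.mul_apply, ← map_mul]
  exact apply_eq_apply_of_smul_eq ρ hK hv (by rw [mul_smul, hsec y hy, hsec _ (hmem hk y hy)])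

/-- **The geometric operator preserves the `K`-fixed vectors.** [cite: Serre1980Trees, Ch. II §1.1–1.3] -/
theorem sum_sphere_mem_fixedPoints (hdist : ∀ (g : G) (x y : W), X.dist (g • x) (g • y) = X.dist x y) (hK : ∀ g : G, g ∈ K ↔ g • x₀ = x₀)
    (S₂ : Finset W) (hS₂ : ∀ y, y ∈ S₂ ↔ X.dist x₀ y = 2) {sec : W → G} (hsec : ∀ y ∈ S₂, sec y • x₀ = y)
    {v : V} (hv : v ∈ ρ.fixedPoints K) : ∑ y ∈ S₂, ρ (sec y) v ∈ ρ.fixedPoints K := by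
  rw [Representation.mem_fixedPoints] at hv ⊢
  exact fun k hk => apply_sum_sphere_eq ρ hdist hK S₂ hS₂ hsec hv hk

end Algebra

/-! ## §2 A finitely supported eigen-coefficient vanishes -/

section Vanishing

variable {G : Type*} [Group G] {W : Type*} [MulAction G W] {X : SimpleGraph W}
variable {V : Type*} [AddCommGroup V] [Module ℂ V]

/-- **MAIN LEMMA («SC-NO-PARAHORIC», generic).**  `G` acts on the leafless tree `X` preserving distances; `x₀` has stabiliser `K`; every vertex at
distance `2` from `x₀` lies in the orbit `G·x₀` (one colour class); `S₂` is the (finite) distance-`2` sphere of `x₀` with a section `sec`.  Let `v` be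
`K`-fixed with `Σ_{y ∈ S₂} ρ(sec y) v = λ • v`, and let `ℓ : V →ₗ ℂ` be such that `g ↦ ℓ(ρ g v)` is non-zero only for `g·x₀` in a finite set of vertices.
Then `ℓ v = 0`.  (The vertex function `g·x₀ ↦ ℓ(ρ g v)` is finitely supported on the orbit and satisfies the distance-`2` relation there; ★ (T-H).)
[cite: Serre1980Trees, Ch. II §1.1–1.3] -/
theorem dual_apply_eq_zero_of_sum_sphere_eq_smul (hX : X.IsTree) (hdeg : ∀ w : W, ∃ w₁ w₂, w₁ ≠ w₂ ∧ X.Adj w w₁ ∧ X.Adj w w₂)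
    (hdist : ∀ (g : G) (x y : W), X.dist (g • x) (g • y) = X.dist x y)
    (x₀ : W) (K : Subgroup G) (hK : ∀ g : G, g ∈ K ↔ g • x₀ = x₀)
    (horb : ∀ y : W, X.dist x₀ y = 2 → y ∈ MulAction.orbit G x₀)
    (S₂ : Finset W) (hS₂ : ∀ y, y ∈ S₂ ↔ X.dist x₀ y = 2) (sec : W → G) (hsec : ∀ y ∈ S₂, sec y • x₀ = y)
    (ρ : Representation ℂ G V) {v : V} (hv : ∀ k ∈ K, ρ k v = v) {lam : ℂ} (hA : ∑ y ∈ S₂, ρ (sec y) v = lam • v)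
    (ℓ : V →ₗ[ℂ] ℂ) (hfs : ∃ S : Finset W, ∀ g : G, ℓ (ρ g v) ≠ 0 → g • x₀ ∈ S) :
    ℓ v = 0 := by
  classical
  -- the vertex function of `v` through `ℓ`
  let f : W → ℂ := fun y => if h : ∃ g : G, g • x₀ = y then ℓ (ρ h.choose v) else 0
  have hf_apply : ∀ g : G, f (g • x₀) = ℓ (ρ g v) := by
    intro g
    have h : ∃ g' : G, g' • x₀ = g • x₀ := ⟨g, rfl⟩
    simp only [f, dif_pos h]
    rw [apply_eq_apply_of_smul_eq ρ hK hv h.choose_spec]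
  have hf_off : ∀ y, (¬ ∃ g : G, g • x₀ = y) → f y = 0 := fun y h => by simp only [f, dif_neg h]
  -- finite support, inside the orbit
  obtain ⟨S, hS⟩ := hfs
  have hfin : (Function.support f).Finite := by
    refine S.finite_toSet.subset fun y hy => ?_
    by_cases h : ∃ g : G, g • x₀ = y
    · obtain ⟨g, rfl⟩ := h
      rw [Function.mem_support, hf_apply] at hy
      exact hS g hy
    · exact absurd (hf_off y h) hy
  set T : Set W := MulAction.orbit G x₀ with hT_def
  have hfT : Function.support f ⊆ T := by
    intro y hy
    by_cases h : ∃ g : G, g • x₀ = y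
    · exact MulAction.mem_orbit_iff.2 h
    · exact absurd (hf_off y h) hy
  have hT : ∀ x y, X.dist x y = 2 → x ∈ T → y ∈ T := by
    rintro x y hxy ⟨g, rfl⟩
    have h2 : X.dist x₀ (g⁻¹ • y) = 2 := by
      rw [← hdist g x₀ (g⁻¹ • y), smul_inv_smul]; exact hxy
    obtain ⟨g', hg'⟩ := MulAction.mem_orbit_iff.1 (horb _ h2)
    exact MulAction.mem_orbit_iff.2 ⟨g * g', by rw [mul_smul, hg', smul_inv_smul]⟩
  -- the distance-2 relation on the orbit
  have heq : ∀ x ∈ T, ∑ᶠ t ∈ {t | X.dist x t = 2}, f t = (fun z => lam * z) (f x) := by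
    rintro x ⟨g, rfl⟩
    have hset : {t | X.dist (g • x₀) t = 2} = (fun y => g • y) '' (S₂ : Set W) := by
      ext t
      constructor
      · intro ht
        refine ⟨g⁻¹ • t, ?_, smul_inv_smul g t⟩
        rw [Finset.mem_coe, hS₂, ← hdist g x₀ (g⁻¹ • t), smul_inv_smul]
        exact ht
      · rintro ⟨y, hy, rfl⟩
        show X.dist (g • x₀) (g • y) = 2
        rw [hdist]
        exact (hS₂ y).1 hy
    show ∑ᶠ t ∈ {t | X.dist (g • x₀) t = 2}, f t = lam * f (g • x₀)
    rw [hset, finsum_mem_image (MulAction.injective g).injOn, finsum_mem_coe_finset]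
    have hterm : ∀ y ∈ S₂, f (g • y) = ℓ (ρ g (ρ (sec y) v)) := by
      intro y hy
      rw [show g • y = (g * sec y) • x₀ by rw [mul_smul, hsec y hy], hf_apply, map_mul, Module.End.mul_apply]
    rw [Finset.sum_congr rfl hterm, ← map_sum, ← map_sum, hA, map_smul, map_smul, smul_eq_mul, hf_apply]
  have h0 := Literature.Combinatorics.SimpleGraph.TreeHarmonic.eq_zero_of_forall_finsum_dist_two_eq hX hdeg f hfin (fun z => lam * z) (mul_zero lam) T hT hfT heq
  have h1 : f ((1 : G) • x₀) = 0 := by rw [h0]; rfl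
  rwa [hf_apply, map_one, Module.End.one_apply] at h1

end Vanishing

/-! ## §3 No fixed vector: the abstract corollary -/

section NoFixed

variable {G : Type*} [Group G] {W : Type*} [MulAction G W] {X : SimpleGraph W}
variable {V : Type*} [AddCommGroup V] [Module ℂ V]

/-- **No `K`-fixed vector (abstract form).**  With the tree data of §2, suppose `V^K` is finite-dimensional and every non-zero `K`-fixed `v` admits a
linear form `ℓ` with `ℓ v ≠ 0` whose coefficient `g ↦ ℓ(ρ g v)` is supported on finitely many vertices `g·x₀`.  Then `V^K = 0`.  (The geometric operator is an
endomorphism of `V^K` (§1) and has an eigenvector over `ℂ`; apply §2.) [cite: Serre1980Trees, Ch. II §1.1–1.3] [cite: Casselman1995, §3.3] -/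
theorem forall_mem_fixedPoints_eq_zero_of_separating (hX : X.IsTree) (hdeg : ∀ w : W, ∃ w₁ w₂, w₁ ≠ w₂ ∧ X.Adj w w₁ ∧ X.Adj w w₂)
    (hdist : ∀ (g : G) (x y : W), X.dist (g • x) (g • y) = X.dist x y)
    (x₀ : W) (K : Subgroup G) (hK : ∀ g : G, g ∈ K ↔ g • x₀ = x₀)
    (horb : ∀ y : W, X.dist x₀ y = 2 → y ∈ MulAction.orbit G x₀)
    (S₂ : Finset W) (hS₂ : ∀ y, y ∈ S₂ ↔ X.dist x₀ y = 2) (sec : W → G) (hsec : ∀ y ∈ S₂, sec y • x₀ = y)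
    (ρ : Representation ℂ G V) [FiniteDimensional ℂ (ρ.fixedPoints K)]
    (hsep : ∀ v ∈ ρ.fixedPoints K, v ≠ 0 → ∃ ℓ : V →ₗ[ℂ] ℂ, ℓ v ≠ 0 ∧ ∃ S : Finset W, ∀ g : G, ℓ (ρ g v) ≠ 0 → g • x₀ ∈ S) :
    ∀ v ∈ ρ.fixedPoints K, v = 0 := by
  classical
  by_contra hne
  push Not at hne
  obtain ⟨v₁, hv₁, hv₁0⟩ := hne
  -- the geometric operator as an endomorphism of `V^K`
  let Asum : V →ₗ[ℂ] V := ∑ y ∈ S₂, ρ (sec y)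
  have hAsum : ∀ v : V, Asum v = ∑ y ∈ S₂, ρ (sec y) v := fun v => by simp only [Asum, LinearMap.sum_apply]
  have hmaps : ∀ v ∈ ρ.fixedPoints K, Asum v ∈ ρ.fixedPoints K := fun v hv => by
    rw [hAsum]; exact sum_sphere_mem_fixedPoints ρ hdist hK S₂ hS₂ hsec hv
  let A : ρ.fixedPoints K →ₗ[ℂ] ρ.fixedPoints K := Asum.restrict hmaps
  haveI : Nontrivial (ρ.fixedPoints K) := ⟨⟨⟨v₁, hv₁⟩, 0, fun h => hv₁0 (congrArg Subtype.val h)⟩⟩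
  obtain ⟨c, hc⟩ := Module.End.exists_eigenvalue A
  obtain ⟨w, hw⟩ := hc.exists_hasEigenvector
  have hw0 : (w : V) ≠ 0 := fun h => hw.2 (Subtype.ext h)
  have hwK : ∀ k ∈ K, ρ k (w : V) = w := (Representation.mem_fixedPoints ρ K w).1 w.2
  have hAw : ∑ y ∈ S₂, ρ (sec y) (w : V) = c • (w : V) := by
    have h := congrArg Subtype.val hw.apply_eq_smul
    simpa only [A, LinearMap.coe_restrict_apply, hAsum, Submodule.coe_smul] using h
  obtain ⟨ℓ, hℓ, hfs⟩ := hsep w w.2 hw0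
  exact hℓ (dual_apply_eq_zero_of_sum_sphere_eq_smul hX hdeg hdist x₀ K hK horb S₂ hS₂ sec hsec ρ hwK hAw ℓ hfs)

end NoFixed

/-! ## §4 The topological discharge: smooth supercuspidal representations, compact centre, compact open stabiliser -/

section Supercuspidal

variable {G : Type*} [Group G] [TopologicalSpace G] [IsTopologicalGroup G] {W : Type*} [MulAction G W] {X : SimpleGraph W}
variable {V : Type*} [AddCommGroup V] [Module ℂ V]

/-- A compact set is covered by finitely many left cosets of an open subgroup: `C ⊆ ⋃_{g ∈ F} g·K`, `F ⊆ C` finite. [cite: Casselman1995, §2.1] -/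
theorem exists_finset_subset_biUnion_smul (K : Subgroup G) (hKo : IsOpen (K : Set G)) {C : Set G} (hC : IsCompact C) :
    ∃ F : Finset G, C ⊆ ⋃ g ∈ F, g • (K : Set G) :=
  hC.elim_finite_subcover (fun g : G => g • (K : Set G)) (fun g => hKo.smul g)
    (fun g _ => Set.mem_iUnion.2 ⟨g, Set.mem_smul_set.2 ⟨1, K.one_mem, mul_one g⟩⟩)

/-- **A smooth linear form from a `K`-fixed vector**: for `K` compact open and `ρ` smooth, `ℓ₀ ∘ e_K` (★ `SmoothProjector.avgLinear`) is `K`-invariant, lies in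
the smooth contragredient, and agrees with `ℓ₀` on `V^K`. [cite: Casselman1995, §2.1] -/
theorem exists_mem_contragredient_apply_eq (ρ : Representation ℂ G V) (hρ : ρ.IsSmooth) (K : Subgroup G) (hKc : IsCompact (K : Set G))
    (hKo : IsOpen (K : Set G)) (ℓ₀ : V →ₗ[ℂ] ℂ) :
    ∃ ℓ : V →ₗ[ℂ] ℂ, ℓ ∈ ρ.contragredient ∧ (∀ k ∈ K, ∀ w : V, ℓ (ρ k w) = ℓ w) ∧ ∀ v ∈ ρ.fixedPoints K, ℓ v = ℓ₀ v := by
  refine ⟨ℓ₀ ∘ₗ SmoothProjector.avgLinear K hρ hKc, ?_, fun k hk w => ?_, fun v hv => ?_⟩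
  · rw [Representation.mem_contragredient]
    refine ρ.dual.isSmoothVector_of_le hKo fun g hg => ?_
    rw [Representation.mem_stabilizerSubgroup]
    refine LinearMap.ext fun a => ?_
    simp only [Representation.dual_apply, Module.Dual.transpose_apply, LinearMap.comp_apply, SmoothProjector.avgLinear_apply]
    rw [SmoothProjector.avg_apply_of_mem (K.inv_mem hg)]
  · simp only [LinearMap.comp_apply, SmoothProjector.avgLinear_apply]
    rw [SmoothProjector.avg_apply_of_mem hk]
  · simp only [LinearMap.comp_apply, SmoothProjector.avgLinear_apply]
    rw [SmoothProjector.avg_eq_self_of_mem_fixedPoints hv]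

/-- **«SC-NO-PARAHORIC» (generic topological form).**  `G` a topological group with COMPACT CENTRE acting on a leafless tree `X` preserving distances, `x₀` a
vertex whose stabiliser `K` is COMPACT OPEN, the orbit `G·x₀` closed under distance-`2` steps, `S₂(x₀)` finite with a section; `ρ` a SMOOTH SUPERCUSPIDAL
representation (★ `Representation.IsSupercuspidal`: smooth matrix coefficients compactly supported modulo the centre) with `V^K` finite-dimensional (admissibility).
Then **`V^K = ⊥`**.  [cite: Serre1980Trees, Ch. II §1.1–1.3] [cite: Casselman1995, §2.1; §3.3] -/
theorem fixedPoints_eq_bot_of_isSupercuspidal (hX : X.IsTree) (hdeg : ∀ w : W, ∃ w₁ w₂, w₁ ≠ w₂ ∧ X.Adj w w₁ ∧ X.Adj w w₂)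
    (hdist : ∀ (g : G) (x y : W), X.dist (g • x) (g • y) = X.dist x y)
    (x₀ : W) (K : Subgroup G) (hK : ∀ g : G, g ∈ K ↔ g • x₀ = x₀) (hKc : IsCompact (K : Set G)) (hKo : IsOpen (K : Set G))
    (horb : ∀ y : W, X.dist x₀ y = 2 → y ∈ MulAction.orbit G x₀)
    (S₂ : Finset W) (hS₂ : ∀ y, y ∈ S₂ ↔ X.dist x₀ y = 2) (sec : W → G) (hsec : ∀ y ∈ S₂, sec y • x₀ = y)
    (hZ : IsCompact ((Subgroup.center G : Subgroup G) : Set G))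
    (ρ : Representation ℂ G V) (hρ : ρ.IsSmooth) (hsc : ρ.IsSupercuspidal) [FiniteDimensional ℂ (ρ.fixedPoints K)] :
    ρ.fixedPoints K = ⊥ := by
  classical
  rw [Submodule.eq_bot_iff]
  refine forall_mem_fixedPoints_eq_zero_of_separating hX hdeg hdist x₀ K hK horb S₂ hS₂ sec hsec ρ fun v hv hv0 => ?_
  -- a functional seeing `v`, averaged over `K`
  obtain ⟨ℓ₀, hℓ₀⟩ : ∃ ℓ₀ : V →ₗ[ℂ] ℂ, ℓ₀ v ≠ 0 := by
    by_contra h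
    push Not at h
    exact hv0 ((Module.forall_dual_apply_eq_zero_iff ℂ v).1 h)
  obtain ⟨ℓ, hℓc, -, hℓv⟩ := exists_mem_contragredient_apply_eq ρ hρ K hKc hKo ℓ₀
  refine ⟨ℓ, by rw [hℓv v hv]; exact hℓ₀, ?_⟩
  -- compact support of the coefficient ⇒ finitely many vertices
  have hcs : HasCompactSupport (ρ.matrixCoeff ℓ v) := hsc.hasCompactSupport_matrixCoeff hZ hℓc v
  obtain ⟨F, hF⟩ := exists_finset_subset_biUnion_smul K hKo hcs.isCompact
  refine ⟨F.image fun g => g • x₀, fun g hg => ?_⟩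
  have hgC : g ∈ tsupport (ρ.matrixCoeff ℓ v) := subset_tsupport _ (by simpa [Function.mem_support, Representation.matrixCoeff_apply] using hg)
  obtain ⟨g₁, hg₁, hgg₁⟩ := Set.mem_iUnion₂.1 (hF hgC)
  obtain ⟨k, hk, rfl⟩ := Set.mem_smul_set.1 hgg₁
  refine Finset.mem_image.2 ⟨g₁, hg₁, ?_⟩
  rw [smul_eq_mul, mul_smul, (hK k).1 hk]

end Supercuspidal

/-! ## §5 The same with the action given as a homomorphism `G →* Equiv.Perm W` (no `MulAction` instance needed by the consumer) -/

section PermHom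

variable {G : Type*} [Group G] [TopologicalSpace G] [IsTopologicalGroup G] {W : Type*} {X : SimpleGraph W}
variable {V : Type*} [AddCommGroup V] [Module ℂ V]

/-- **«SC-NO-PARAHORIC», action-by-homomorphism form.**  As `fixedPoints_eq_bot_of_isSupercuspidal`, with the action of `G` on the vertices supplied as a group
homomorphism `act : G →* Equiv.Perm W` preserving adjacency (e.g. `u ↦ latticeGraphPerm σ ϖ H u` on the ★ lattice tree, a homomorphism by ★ `mapGL_mul`), so that
no `MulAction G W` instance has to exist at the call site. [cite: Serre1980Trees, Ch. II §1.1–1.3] [cite: Casselman1995, §2.1; §3.3] -/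
theorem fixedPoints_eq_bot_of_isSupercuspidal_of_permHom (hX : X.IsTree) (hdeg : ∀ w : W, ∃ w₁ w₂, w₁ ≠ w₂ ∧ X.Adj w w₁ ∧ X.Adj w w₂)
    (act : G →* Equiv.Perm W) (hadj : ∀ (g : G) (x y : W), X.Adj (act g x) (act g y) ↔ X.Adj x y)
    (x₀ : W) (K : Subgroup G) (hK : ∀ g : G, g ∈ K ↔ act g x₀ = x₀) (hKc : IsCompact (K : Set G)) (hKo : IsOpen (K : Set G))
    (horb : ∀ y : W, X.dist x₀ y = 2 → ∃ g : G, act g x₀ = y)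
    (S₂ : Finset W) (hS₂ : ∀ y, y ∈ S₂ ↔ X.dist x₀ y = 2) (sec : W → G) (hsec : ∀ y ∈ S₂, act (sec y) x₀ = y)
    (hZ : IsCompact ((Subgroup.center G : Subgroup G) : Set G))
    (ρ : Representation ℂ G V) (hρ : ρ.IsSmooth) (hsc : ρ.IsSupercuspidal) [FiniteDimensional ℂ (ρ.fixedPoints K)] :
    ρ.fixedPoints K = ⊥ := by
  letI : MulAction G W := MulAction.compHom W act
  have hsmul : ∀ (g : G) (x : W), g • x = act g x := fun _ _ => rfl
  refine fixedPoints_eq_bot_of_isSupercuspidal hX hdeg (fun g x y => ?_) x₀ K (fun g => by rw [hK, hsmul]) hKc hKo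
    (fun y hy => ?_) S₂ hS₂ sec (fun y hy => by rw [hsmul]; exact hsec y hy) hZ ρ hρ hsc
  · exact dist_smul_eq_of_forall_adj_iff (fun g x y => by rw [hsmul, hsmul]; exact hadj g x y) g x y
  · obtain ⟨g, hg⟩ := horb y hy
    exact MulAction.mem_orbit_iff.2 ⟨g, by rw [hsmul]; exact hg⟩

end PermHom

end Literature.RepresentationTheory.TreeAction
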